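import Summits.CriticalPhenomena.PercolationContinuityZ3.Theorems.Transplant.SkelPhiParamsKit
import Summits.CriticalPhenomena.PercolationContinuityZ3.Theorems.Transplant.PlanarCells2Defs
import Summits.CriticalPhenomena.PercolationContinuityZ3.Theorems.Transplant.BoxProdZ2ConcParamsKit
import HarnessLib

/-!
# D″ L7′ params, part 3 (φ-level, consumer-independent): THE CELL BLOCK OF `signChoice₀` — the unit ratio `A := K·a` (`a := 48/K + 1`, so `A ≥ 48`,
# `A ≥ K ≥ ⌈K/5⌉ + 1`, and the two-unit cells `r_i = K·s_i` hit `r_i = A·e_i` on the nose with `s_i := a·e_i`), the long-stride factor `L := A/17`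
# (`2·L·8 ≤ A`), the UNIT EXTRACTION from the Step-I′ two-unit property by classical choice (`Skelφ.Prm.units D c A L n₀`, spec under the existential
# that `StepI.TwoUnitL`/`StepI.TwoUnit` deliver), the cells `Skelφ.Prm.cells K a hK e : PCells2`, and the FINITE LISTS `SzOf`/`SxOf` with their
# membership and admissibility lemmas (`Choice.S_adm`) — ledger HOME/prim-bschramm-stmt/SIGN-PARAMS.md §0-bis (ORDER N.3), DPRIME-SCOPE p3 addendum N

builds on p205010 (kernel theorem, internal audit signed; external expert review pending) — nothing in this file uses p205010.
Status sentence (coordinator 2026-08-20T04:30Z): "θ(p_c) = 0 on ℤ^d, all d ≥ 2 — kernel-verified (Lean 4/Mathlib, standard axioms); internal adversarial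
audit SIGNED 2026-08-20 04:29Z; external expert review pending."
Lane `prim-bschramm-*`, seat `prim-bschramm-stmt` (gen 9); helper file (`--supports stmt-CriticalPhenomena-4575`).
ORDER (addendum N.3, binding): `K := Kof K₀ → A → L → … → Step I′ (m₀ := 2L + 1, so that `TwoAxis.exists_twoUnitL`'s `2L + 1 ≤ m` holds) → M_u → kit scalars
(`SkelPhiParamsKit`) → Rlev, R′ → n₀ := max (M_u + R′ + 1) (40·A·R′) → (eₓ, e_y) := units at (c := 8, A, L, n₀) → cells → strides e / L·e → lists`.  This file
supplies the q-free, consumer-independent pieces; the values `R′`, `n₀`, `ℓ1`, `ℓ₀`, `ℓtop` are arguments here and are fixed in `signChoice₀`.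
* §1 `aOf`, `Ac`, `Lc` + `Ac_eq`, `fortyeight_le_Ac`, `le_Ac` (`K ≤ A`), `one_le_Lc`, `sixteen_Lc_le_Ac` (`2·L·8 ≤ A`), `seventeen_Lc_le_Ac`;
* §2 `UnitSpec D c A L n₀ ex ey` (= the body of the two-unit existential), `units`, `units_spec`, `eOf` (`e 0 = eₓ`, `e 1 = e_y`) + its bounds;
* §3 `cells K a hK e : PCells2` (`s i := max 1 (a·e i)`), `cells_K`, `cells_r` (`r i = K·a·e i` once `1 ≤ a·e i`), `le_cells_r`, `cells_rmax_ge`;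
* §4 `SzOf Mu := {Mu}`, `SxOf Mu ℓ1 ℓ₀ ℓtop := {Mu+1, ℓ1} ∪ Icc ℓ₀ ℓtop` + `Mu_mem_SzOf`, `succ_mem_SxOf`, `ℓ1_mem_SxOf`, `mem_SxOf_of_Icc`, `SzOf_adm`, `SxOf_adm`.
[cite: KozmaNitzan2024, §4 Theorem 6 (pp. 25–31): the order of constants; Lemma 11 (pp. 22–23)]
-/

namespace Summit.CriticalPhenomena.PercolationContinuityZ3.Theorems.Transplant

namespace Skelφ

namespace Prm

open Literature.Probability.Percolation Literature.Probability.LatticeModels SimpleGraph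
open BoxProdZ2 (Kof twenty_le_Kof le_Kof)
open scoped Classical

variable {V : Type}

/-! ## §1 The unit ratio `A = K·a` and the long-stride factor `L = A/17` -/

/-- The cell multiplier `a := 48/K + 1` (`s_i := a·e_i`). [this work] -/
def aOf (K : ℕ) : ℕ := 48 / K + 1

/-- **The unit ratio `A := K·a`** (`r_i = A·e_i`; `A ≥ 48`, `A ≥ K`). [this work] -/
def Ac (K : ℕ) : ℕ := K * aOf K

/-- **The long-stride factor `L := A/17`** (long strides `L·e`; `2·L·c ≤ A` for the room constant `c = 8`, with slack). [this work] -/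
def Lc (K : ℕ) : ℕ := Ac K / 17

/-- `A = K·a`. [folklore] -/
theorem Ac_eq (K : ℕ) : Ac K = K * aOf K := rfl

/-- `1 ≤ a`. [folklore] -/
theorem one_le_aOf (K : ℕ) : 1 ≤ aOf K := Nat.le_add_left 1 _

/-- `K ≤ A`. [folklore] -/
theorem le_Ac (K : ℕ) : K ≤ Ac K := by
  unfold Ac
  exact Nat.le_mul_of_pos_right K (one_le_aOf K)

/-- `48 ≤ A` for `K ≥ 1` (`K·(48/K) ≥ 48 − (K − 1)`). [folklore] -/
theorem fortyeight_le_Ac {K : ℕ} (hK : 1 ≤ K) : 48 ≤ Ac K := by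
  unfold Ac aOf
  have h1 : 48 % K < K := Nat.mod_lt 48 (by omega)
  have h2 : K * (48 / K) + 48 % K = 48 := Nat.div_add_mod 48 K
  rw [Nat.mul_add, Nat.mul_one]
  omega

/-- `48 ≤ A` at `K := Kof K₀`. [folklore] -/
theorem fortyeight_le_Ac_Kof (K₀ : ℕ) : 48 ≤ Ac (Kof K₀) := fortyeight_le_Ac (le_trans (by norm_num) (twenty_le_Kof K₀))

/-- `17·L ≤ A`. [folklore] -/
theorem seventeen_Lc_le_Ac (K : ℕ) : 17 * Lc K ≤ Ac K := by unfold Lc; omega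

/-- `2·L·8 ≤ A` (the hypothesis `2·L·c ≤ A` of the two-unit property at `c = 8`). [folklore] -/
theorem sixteen_Lc_le_Ac (K : ℕ) : 2 * Lc K * 8 ≤ Ac K := by unfold Lc; omega

/-- `1 ≤ L` for `K ≥ 1` (indeed `L ≥ 2` since `A ≥ 48`). [folklore] -/
theorem one_le_Lc {K : ℕ} (hK : 1 ≤ K) : 1 ≤ Lc K := by
  have := fortyeight_le_Ac hK
  unfold Lc; omega

/-- `2 ≤ L` for `K ≥ 1`. [folklore] -/
theorem two_le_Lc {K : ℕ} (hK : 1 ≤ K) : 2 ≤ Lc K := by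
  have := fortyeight_le_Ac hK
  unfold Lc; omega

/-- `L ≤ A`. [folklore] -/
theorem Lc_le_Ac (K : ℕ) : Lc K ≤ Ac K := by unfold Lc; omega

/-! ## §2 The unit extraction -/

/-- **The two-unit specification** of a pair `(eₓ, e_y)` for the data `D` at `(c, A, L, n₀)`: both above the floor `n₀` and the seed scale `D.k`,
`c·Gb(L·eₓ) ≤ A·e_y` and `c·Fb(L·e_y) ≤ A·eₓ` (the matrix of `StepI.TwoUnitL` / `StepI.TwoUnit` at `L = 3`). [cite: KozmaNitzan2024, §4 Lemma 11 (pp. 22–23)] -/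
def UnitSpec (D : StepI.Data V) (c A L n₀ ex ey : ℕ) : Prop :=
  n₀ ≤ ex ∧ n₀ ≤ ey ∧ D.k ≤ ex ∧ D.k ≤ ey ∧ c * D.Gb (L * ex) ≤ A * ey ∧ c * D.Fb (L * ey) ≤ A * ex

/-- **The units by classical choice** (default `(1, 1)` off the existential; the spec lemma needs the existential). [this work] -/
noncomputable def units (D : StepI.Data V) (c A L n₀ : ℕ) : ℕ × ℕ :=
  if h : ∃ ex ey, UnitSpec D c A L n₀ ex ey then (Classical.choose h, Classical.choose (Classical.choose_spec h)) else (1, 1)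

/-- **The units satisfy the specification** whenever some pair does. [folklore] -/
theorem units_spec {D : StepI.Data V} {c A L n₀ : ℕ} (h : ∃ ex ey, UnitSpec D c A L n₀ ex ey) :
    UnitSpec D c A L n₀ (units D c A L n₀).1 (units D c A L n₀).2 := by
  unfold units
  rw [dif_pos h]
  exact Classical.choose_spec (Classical.choose_spec h)

/-- The units are `≥ 1` (by the default, or by `D.k ≥ 1` under the specification). [folklore] -/
theorem one_le_units {D : StepI.Data V} (hk : 1 ≤ D.k) (c A L n₀ : ℕ) : 1 ≤ (units D c A L n₀).1 ∧ 1 ≤ (units D c A L n₀).2 := by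
  by_cases h : ∃ ex ey, UnitSpec D c A L n₀ ex ey
  · have hs := units_spec h
    exact ⟨hk.trans hs.2.2.1, hk.trans hs.2.2.2.1⟩
  · unfold units; rw [dif_neg h]; exact ⟨le_rfl, le_rfl⟩

/-- **The unit vector** `e 0 := eₓ`, `e 1 := e_y`. [this work] -/
noncomputable def eOf (D : StepI.Data V) (c A L n₀ : ℕ) : Fin 2 → ℕ := fun i => if i = 0 then (units D c A L n₀).1 else (units D c A L n₀).2

/-- `e 0 = eₓ`, `e 1 = e_y`. [folklore] -/
theorem eOf_zero_one (D : StepI.Data V) (c A L n₀ : ℕ) :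
    eOf D c A L n₀ 0 = (units D c A L n₀).1 ∧ eOf D c A L n₀ 1 = (units D c A L n₀).2 := ⟨rfl, rfl⟩

/-- Under the specification: `n₀ ≤ e i` and `D.k ≤ e i` for both axes. [folklore] -/
theorem le_eOf {D : StepI.Data V} {c A L n₀ : ℕ} (h : ∃ ex ey, UnitSpec D c A L n₀ ex ey) (i : Fin 2) :
    n₀ ≤ eOf D c A L n₀ i ∧ D.k ≤ eOf D c A L n₀ i := by
  have hs := units_spec h
  unfold eOf
  fin_cases i
  · exact ⟨hs.1, hs.2.2.1⟩
  · exact ⟨hs.2.1, hs.2.2.2.1⟩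

/-- Under the specification: the two room inequalities `c·Gb(L·e₀) ≤ A·e₁`, `c·Fb(L·e₁) ≤ A·e₀`. [folklore] -/
theorem eOf_rooms {D : StepI.Data V} {c A L n₀ : ℕ} (h : ∃ ex ey, UnitSpec D c A L n₀ ex ey) :
    c * D.Gb (L * eOf D c A L n₀ 0) ≤ A * eOf D c A L n₀ 1 ∧ c * D.Fb (L * eOf D c A L n₀ 1) ≤ A * eOf D c A L n₀ 0 := by
  have hs := units_spec h
  exact ⟨hs.2.2.2.2.1, hs.2.2.2.2.2⟩

/-- `1 ≤ e i` (always). [folklore] -/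
theorem one_le_eOf {D : StepI.Data V} (hk : 1 ≤ D.k) (c A L n₀ : ℕ) (i : Fin 2) : 1 ≤ eOf D c A L n₀ i := by
  have h := one_le_units hk c A L n₀
  unfold eOf
  fin_cases i
  · exact h.1
  · exact h.2

/-! ## §3 The two-unit cells -/

/-- **The two-unit planar cells** `⟨K, s, hK, hs⟩` with `s i := max 1 (a·e i)` (so `r i = K·a·e i = A·e i` once `a·e i ≥ 1`). [cite: KozmaNitzan2024, §4 p. 26] -/
def cells (K a : ℕ) (hK : 20 ≤ K) (e : Fin 2 → ℕ) : PCells2 := ⟨K, fun i => max 1 (a * e i), hK, fun _ => le_max_left _ _⟩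

/-- `(cells …).K = K`. [folklore] -/
@[simp] theorem cells_K (K a : ℕ) (hK : 20 ≤ K) (e : Fin 2 → ℕ) : (cells K a hK e).K = K := rfl

/-- `(cells …).s i = max 1 (a·e i)`. [folklore] -/
@[simp] theorem cells_s (K a : ℕ) (hK : 20 ≤ K) (e : Fin 2 → ℕ) (i : Fin 2) : (cells K a hK e).s i = max 1 (a * e i) := rfl

/-- **`r i = K·a·e i`** when `1 ≤ a` and `1 ≤ e i`. [folklore] -/
theorem cells_r {K a : ℕ} (hK : 20 ≤ K) {e : Fin 2 → ℕ} (ha : 1 ≤ a) {i : Fin 2} (he : 1 ≤ e i) : (cells K a hK e).r i = K * a * e i := by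
  have h1 : 1 ≤ a * e i := Nat.one_le_iff_ne_zero.2 (Nat.mul_ne_zero (by omega) (by omega))
  show K * max 1 (a * e i) = K * a * e i
  rw [max_eq_right h1, Nat.mul_assoc]

/-- `K·a·e i ≤ r i` (always). [folklore] -/
theorem le_cells_r (K a : ℕ) (hK : 20 ≤ K) (e : Fin 2 → ℕ) (i : Fin 2) : K * a * e i ≤ (cells K a hK e).r i := by
  show K * a * e i ≤ K * max 1 (a * e i)
  rw [Nat.mul_assoc]
  exact Nat.mul_le_mul_left K (le_max_right _ _)

/-- `K ≤ r i` (so `20 ≤ r i ≤ rmax`, in particular `4 ≤ rmax`). [folklore] -/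
theorem K_le_cells_r (K a : ℕ) (hK : 20 ≤ K) (e : Fin 2 → ℕ) (i : Fin 2) : K ≤ (cells K a hK e).r i := by
  show K ≤ K * max 1 (a * e i)
  exact Nat.le_mul_of_pos_right K (lt_of_lt_of_le Nat.one_pos (le_max_left _ _))

/-- `20 ≤ rmax` (hence `4 ≤ rmax` for `Skelφ.Prm.fortyfour_le_E₀`). [folklore] -/
theorem twenty_le_cells_rmax (K a : ℕ) (hK : 20 ≤ K) (e : Fin 2 → ℕ) : 20 ≤ (cells K a hK e).rmax :=
  le_trans (hK.trans (K_le_cells_r K a hK e 0)) ((cells K a hK e).r_le_rmax 0)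

/-- `r i ≤ rmax` (re-export). [folklore] -/
theorem cells_r_le_rmax (K a : ℕ) (hK : 20 ≤ K) (e : Fin 2 → ℕ) (i : Fin 2) : (cells K a hK e).r i ≤ (cells K a hK e).rmax :=
  (cells K a hK e).r_le_rmax i

/-! ## §4 The finite lists -/

/-- **The zone-scale list** `Sz := {M_u}`. [this work] -/
def SzOf (Mu : ℕ) : Finset ℕ := {Mu}

/-- **An extent list** `Sx := {M_u + 1, ℓ1} ∪ Icc ℓ₀ ℓtop` (kit link extent, first-hop extent, the band/Loc route range). [this work] -/
def SxOf (Mu ℓ1 ℓ₀ ℓtop : ℕ) : Finset ℕ := {Mu + 1, ℓ1} ∪ Finset.Icc ℓ₀ ℓtop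

/-- `M_u ∈ Sz`. [folklore] -/
theorem Mu_mem_SzOf (Mu : ℕ) : Mu ∈ SzOf Mu := Finset.mem_singleton_self _

/-- `M_u + 1 ∈ Sx` (the kit link extent). [folklore] -/
theorem succ_mem_SxOf (Mu ℓ1 ℓ₀ ℓtop : ℕ) : Mu + 1 ∈ SxOf Mu ℓ1 ℓ₀ ℓtop :=
  Finset.mem_union_left _ (Finset.mem_insert_self _ _)

/-- `ℓ1 ∈ Sx` (the first-hop extent). [folklore] -/
theorem ℓ1_mem_SxOf (Mu ℓ1 ℓ₀ ℓtop : ℕ) : ℓ1 ∈ SxOf Mu ℓ1 ℓ₀ ℓtop :=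
  Finset.mem_union_left _ (Finset.mem_insert_of_mem (Finset.mem_singleton_self _))

/-- `Icc ℓ₀ ℓtop ⊆ Sx` (the route range), pointwise (`hS0`/`hS1` shape of `kitClause_stepI`). [folklore] -/
theorem mem_SxOf_of_Icc (Mu ℓ1 : ℕ) {ℓ₀ ℓtop ℓ : ℕ} (h₀ : ℓ₀ ≤ ℓ) (h₁ : ℓ ≤ ℓtop) : ℓ ∈ SxOf Mu ℓ1 ℓ₀ ℓtop :=
  Finset.mem_union_right _ (Finset.mem_Icc.2 ⟨h₀, h₁⟩)

/-- `Icc ℓ₀ ℓtop ⊆ Sx` as a subset. [folklore] -/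
theorem Icc_subset_SxOf (Mu ℓ1 ℓ₀ ℓtop : ℕ) : Finset.Icc ℓ₀ ℓtop ⊆ SxOf Mu ℓ1 ℓ₀ ℓtop := Finset.subset_union_right

/-- **Admissibility of `Sz`**: every zone scale is `≥ M₀` once `M₀ ≤ M_u`. [folklore] -/
theorem SzOf_adm {M₀ Mu : ℕ} (h : M₀ ≤ Mu) : ∀ M ∈ SzOf Mu, M₀ ≤ M := fun M hM => by
  rw [SzOf, Finset.mem_singleton] at hM; omega

/-- **Admissibility of `Sx`**: every extent is `≥ n₁` once `n₁ ≤ M_u + 1`, `M_u + 1 ≤ ℓ1`, `M_u + 1 ≤ ℓ₀`. [folklore] -/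
theorem SxOf_adm {n₁ Mu ℓ1 ℓ₀ ℓtop : ℕ} (h : n₁ ≤ Mu + 1) (h1 : Mu + 1 ≤ ℓ1) (h0 : Mu + 1 ≤ ℓ₀) : ∀ ℓ ∈ SxOf Mu ℓ1 ℓ₀ ℓtop, n₁ ≤ ℓ := by
  intro ℓ hℓ
  rcases Finset.mem_union.1 hℓ with h' | h'
  · rcases Finset.mem_insert.1 h' with rfl | h''
    · omega
    · rw [Finset.mem_singleton] at h''; omega
  · have := (Finset.mem_Icc.1 h').1; omega

/-- Every member of `Sx` is `≥ M_u + 1` under the same floors (so route extents clear the kit zone box: `hMℓ`). [folklore] -/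
theorem succ_le_of_mem_SxOf {Mu ℓ1 ℓ₀ ℓtop : ℕ} (h1 : Mu + 1 ≤ ℓ1) (h0 : Mu + 1 ≤ ℓ₀) : ∀ ℓ ∈ SxOf Mu ℓ1 ℓ₀ ℓtop, Mu + 1 ≤ ℓ :=
  SxOf_adm le_rfl h1 h0

end Prm

end Skelφ

end Summit.CriticalPhenomena.PercolationContinuityZ3.Theorems.Transplant
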